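import Mathlib
import HarnessLib
import Summits.CriticalPhenomena.Ising3DConformalLimit.Theses.ClusterRigidity

/-!
# Crux `ClusterRigidity.ClusterSetTotallyDisconnected` (stmt-CriticalPhenomena-4659) — birth skeleton (`Lines/birth.lean`)

Skeleton registrar `planner-skel-stmt-CriticalPhenomena-4659-0`, 2026-08-17 (BC3 of the Lean birth
certificate; route `route-CriticalPhenomena-ClusterRigidity`, re-audit bin REPAIRABLE).  The crux is
FIXED: its decl and signature are the route's (`Theses/ClusterRigidity.lean`, item 4659, rank 4, "TD");
`ClusterSetTotallyDisconnected_of` below concludes it BY NAME.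

## The crux

`IsTotallyDisconnected 𝒞` for the CLUSTER SET
`𝒞 := {S : CorrFamily 3 | S = 0 off NonCoincident ∧ ∃ u : ℕ → (0,1], u → 0, ∀ n, F_{u k}(n,·) → S n
locally uniformly on NonCoincident 3 n}` of the SELF-NORMALISED rescaled critical correlators
`F_δ(n,x) := ρ★(δ)^n ⟨∏ σ_{⌊xᵢ/δ⌋}⟩_{β_c(3)}`, `ρ★(δ) := ⟨σ₀ σ_{⌊1/δ⌋e₁}⟩^{-1/2}`, in the pointwise
(product) topology of `CorrFamily 3 = Π n, ((Fin n → ℝ³) → ℝ)`.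

## The cut (two-point rigidity ∣ isolation at fixed two-point function), glued by a proved
## "continuous invariant with totally disconnected range" lemma

The two-point map `π₂ : S ↦ S 2` is a continuous invariant of cluster points (a coordinate
projection of the product topology).  A preconnected `t ⊆ 𝒞` has preconnected image `π₂ '' t`;
if the set of TWO-POINT cluster functions `π₂ '' 𝒞` is totally disconnected, `π₂` is constant on
`t`, i.e. `t` lies in one two-point fibre of `𝒞`; if every fibre is totally disconnected, `t` is a
subsingleton.  Hence (glue lemma `isTotallyDisconnected_of_fibres`, proved — the fibrewise
generalisation of Mathlib's `isTotallyDisconnected_of_image`, whose injectivity hypothesis is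
exactly "fibres are subsingletons"):

* `stub_twoPointImageTD` (OPEN, open-problem — "the anomalous dimension does not drift"): the set
  `π₂ '' 𝒞` of two-point functions of cluster points is totally disconnected (pointwise topology on
  `(Fin 2 → ℝ³) → ℝ`).  Under `UniformRegularity` (item 4658: `𝒞` compact, connected) this is
  EQUIVALENT to full-filter convergence of the self-normalised TWO-POINT function alone
  (`π₂ '' 𝒞` is then a continuum, so TD ⇔ singleton), i.e. to a sharp pure-power asymptotic
  `⟨σ₀σ_x⟩ ~ c‖x‖^{-(1+η)}` read through the self-normalisation — the `n = 2` slice of the crux and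
  the place where the route's lattice partial engine lands: `DimensionPinned` (item 4662, two-sided
  `‖x‖^{-(1+η)}` bounds) + the scale part of `ClusterPointsMoebius` (item 4657) + the pinned frame
  `S 2 (0,e₁) = 1` (refuter rattack-4659, `clusterPoint_two_e01`) force ONE two-point function
  `‖x−y‖^{-(1+η)}` on `𝒞`, and a singleton image is totally disconnected (`twoPointImageTD_of_pinned`,
  proved below).  It kills two of the three recorded failure modes of the crux BY ITSELF: a slowly
  drifting exponent `g = n^{-2Δ(n)}` (arc of pure-power cluster points) and the long-range arc
  `Δ_σ = (3−s)/2` (varying `Δ_σ`) both give a non-degenerate CONTINUUM of two-point functions.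
* `stub_fibrewiseTD` (OPEN, open-problem — LOAD-BEARING, the CFT-rigidity content proper): for every
  two-point function `G`, the fibre `{S ∈ 𝒞 | S 2 = G}` is totally disconnected — isolation of
  admissible limits AT FIXED `Δ_σ` AND FIXED TWO-POINT NORMALISATION.  Strictly weaker than the crux
  (a subset of a totally disconnected set is totally disconnected) and weaker than the route's
  intended engine "Ising-like local CFT data are isolated" (only the codimension-≥ 1 slice
  `Δ_σ = const` of the would-be conformal manifold has to be excluded: an exactly marginal
  deformation that MOVES `Δ_σ` is already excluded by stub 1); the strongest natural form,
  "the two-point function determines the cluster point" (`π₂` injective on `𝒞`), also discharges it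
  (`fibrewiseTD_of_injOn`, proved below).  Under `UniformRegularity` + stub 1 it carries exactly
  "convergence of all `n ≥ 3`-point functions given convergence of the two-point function".

Neither stub alone gives the crux: stub 1 constrains only `n = 2` (a totally disconnected image says
nothing about the fibres), stub 2 only the fibres (it holds vacuously-in-kind for ANY family whose
cluster points are pairwise distinguished by their two-point functions, e.g. an arc of GFF-like
families `‖x−y‖^{-2Δ}`, `Δ` in an interval, which is NOT totally disconnected).

Disproof used: none exists for this crux (`ledger crux ls stmt-CriticalPhenomena-4659`: no workfiles
before this one; no `Theorems/…/Negative/` for this decl).  Refuter evidence honoured: rattack-4659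
`clusterSetTotallyDisconnected_of_summit : Ising3DConformalLimit → TD` (the crux is a CONSEQUENCE of
the summit; so are both stubs — consistent, no stub contradicts a landed fact) and the rreview
orbit lemma (under Reg, TD ⇒ scale covariance) is not assumed anywhere.  Negatives index: no stub
restates a refuted statement (the 0663/0666 degenerate-renormalisation witnesses live in the `∀ ρ`
frame; here the frame is pinned by `ρ★`).
BC3 probes (registrar's folder `bc/probe_<stub>.lean`): for each stub, `stub → ClusterSetTotallyDisconnected`
and `stub → Ising3DConformalLimit` by `exact?` / `simpa using h` / `simpa [target] using h` / `aesop`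
(and the combined `first | …`) all FAIL — see `Lines/birth.md`.
-/

set_option maxHeartbeats 1000000

namespace Summit.CriticalPhenomena.Ising3DConformalLimit.Cruxes.ClusterSetTotallyDisconnected.Birth

open scoped BigOperators Topology Classical
open Filter Set Function TopologicalSpace


/-- stub 1 (OPEN, open-problem; the `n = 2` slice — "Δ_σ does not drift"): **the two-point cluster
functions form a totally disconnected set** — the image of the cluster set `𝒞` of the self-normalised
critical correlators under the two-point projection `S ↦ S 2` is totally disconnected in the
pointwise topology.  Under `UniformRegularity` equivalent to full-filter convergence of the
self-normalised two-point function; discharged (as a singleton image) by `DimensionPinned` + scale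
covariance of cluster points + the pinned frame `S 2 (0,e₁) = 1`. -/
theorem stub_twoPointImageTD : open Literature.Probability.LatticeModels in IsTotallyDisconnected ((fun S : CorrFamily 3 => S 2) '' {S : CorrFamily 3 | (∀ n x, x ∉ NonCoincident 3 n → S n x = 0) ∧ ∃ u : ℕ → ℝ, (∀ k, u k ∈ Set.Ioc (0:ℝ) 1) ∧ Filter.Tendsto u Filter.atTop (nhds 0) ∧ ∀ n, TendstoLocallyUniformlyOn (fun k => rescaledCorrelator (criticalCorr 3) (fun δ : ℝ => (criticalTwoPoint 3 (Pi.single 0 ⌊δ⁻¹⌋)) ^ (-(1/2:ℝ))) n (u k)) (S n) Filter.atTop (NonCoincident 3 n)}) := by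
  sorry


/-- stub 2 (OPEN, open-problem; LOAD-BEARING — isolation at fixed two-point function): **every
two-point fibre of the cluster set is totally disconnected** — for every `G`, the cluster points of
the self-normalised critical correlators whose two-point function is `G` form a totally disconnected
set (pointwise topology of `CorrFamily 3`).  Strictly weaker than the crux; the slice `Δ_σ = const`
of the route's CFT-isolation engine; discharged by "the two-point function determines the cluster
point" (`π₂` injective on `𝒞`). -/
theorem stub_fibrewiseTD : open Literature.Probability.LatticeModels in ∀ G : (Fin 2 → EuclideanSpace ℝ (Fin 3)) → ℝ, IsTotallyDisconnected {S : CorrFamily 3 | ((∀ n x, x ∉ NonCoincident 3 n → S n x = 0) ∧ ∃ u : ℕ → ℝ, (∀ k, u k ∈ Set.Ioc (0:ℝ) 1) ∧ Filter.Tendsto u Filter.atTop (nhds 0) ∧ ∀ n, TendstoLocallyUniformlyOn (fun k => rescaledCorrelator (criticalCorr 3) (fun δ : ℝ => (criticalTwoPoint 3 (Pi.single 0 ⌊δ⁻¹⌋)) ^ (-(1/2:ℝ))) n (u k)) (S n) Filter.atTop (NonCoincident 3 n)) ∧ S 2 = G} := by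
  sorry


/-! ### Name-keyed aliases of the two stub statements (verbatim the types of the `stub_*` theorems
above; the skeleton audit admits hypotheses of `ClusterSetTotallyDisconnected_of` only BY NAME) -/
namespace Registered

/-- Alias of the statement of `stub_twoPointImageTD`, keyed by the registered stub name. -/
abbrev stub_twoPointImageTD : Prop := open Literature.Probability.LatticeModels in IsTotallyDisconnected ((fun S : CorrFamily 3 => S 2) '' {S : CorrFamily 3 | (∀ n x, x ∉ NonCoincident 3 n → S n x = 0) ∧ ∃ u : ℕ → ℝ, (∀ k, u k ∈ Set.Ioc (0:ℝ) 1) ∧ Filter.Tendsto u Filter.atTop (nhds 0) ∧ ∀ n, TendstoLocallyUniformlyOn (fun k => rescaledCorrelator (criticalCorr 3) (fun δ : ℝ => (criticalTwoPoint 3 (Pi.single 0 ⌊δ⁻¹⌋)) ^ (-(1/2:ℝ))) n (u k)) (S n) Filter.atTop (NonCoincident 3 n)})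

/-- Alias of the statement of `stub_fibrewiseTD`, keyed by the registered stub name. -/
abbrev stub_fibrewiseTD : Prop := open Literature.Probability.LatticeModels in ∀ G : (Fin 2 → EuclideanSpace ℝ (Fin 3)) → ℝ, IsTotallyDisconnected {S : CorrFamily 3 | ((∀ n x, x ∉ NonCoincident 3 n → S n x = 0) ∧ ∃ u : ℕ → ℝ, (∀ k, u k ∈ Set.Ioc (0:ℝ) 1) ∧ Filter.Tendsto u Filter.atTop (nhds 0) ∧ ∀ n, TendstoLocallyUniformlyOn (fun k => rescaledCorrelator (criticalCorr 3) (fun δ : ℝ => (criticalTwoPoint 3 (Pi.single 0 ⌊δ⁻¹⌋)) ^ (-(1/2:ℝ))) n (u k)) (S n) Filter.atTop (NonCoincident 3 n)) ∧ S 2 = G}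

end Registered


/-! ### Glue (all proved): the fibrewise total-disconnectedness principle, the crux's vocabulary as
### definitions, and the two natural dischargers of the stubs -/
section Glue

variable {X Y : Type*} [TopologicalSpace X] [TopologicalSpace Y]

/-- RIGIDITY VIA A CONTINUOUS INVARIANT WITH TOTALLY DISCONNECTED RANGE (the glue lemma): if `f` is
continuous on `s`, the image `f '' s` is totally disconnected, and every fibre `{x ∈ s | f x = y}` is
totally disconnected, then `s` is totally disconnected.  (A preconnected `t ⊆ s` has preconnected,
hence one-point, image, so it lies in a single fibre.)  Mathlib's `isTotallyDisconnected_of_image` is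
the special case `f` injective (fibres subsingletons). [folklore] -/
theorem isTotallyDisconnected_of_fibres {s : Set X} (f : X → Y) (hf : ContinuousOn f s)
    (himg : IsTotallyDisconnected (f '' s))
    (hfib : ∀ y, IsTotallyDisconnected {x : X | x ∈ s ∧ f x = y}) :
    IsTotallyDisconnected s := by
  intro t hts ht
  rcases t.eq_empty_or_nonempty with rfl | ⟨x₀, hx₀⟩
  · exact subsingleton_empty
  -- the image of `t` is a preconnected subset of the totally disconnected `f '' s`: one point
  have himg_t : (f '' t).Subsingleton :=
    himg (f '' t) (image_mono hts) (ht.image f (hf.mono hts))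
  -- hence `t` lies in the fibre of `f x₀`, which is totally disconnected
  refine hfib (f x₀) t (fun x hx => ⟨hts hx, ?_⟩) ht
  exact himg_t (mem_image_of_mem f hx) (mem_image_of_mem f hx₀)

/-- A set contained in a singleton-or-empty set of values is totally disconnected: if all points of
`s` are equal, `s` is totally disconnected. [folklore] -/
theorem isTotallyDisconnected_of_subsingleton {s : Set X} (hs : s.Subsingleton) :
    IsTotallyDisconnected s :=
  fun _t hts _ => hs.anti hts

open Literature.Probability.LatticeModels

/-- The forced renormalisation `ρ★(δ) := ⟨σ₀ σ_{⌊δ⁻¹⌋ e₁}⟩_{β_c(3)}^{-1/2}` of the route (verbatim the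
crux's `fun δ => (criticalTwoPoint 3 (Pi.single 0 ⌊δ⁻¹⌋)) ^ (-(1/2))`). -/
noncomputable def rhoStar : ℝ → ℝ := fun δ : ℝ => (criticalTwoPoint 3 (Pi.single 0 ⌊δ⁻¹⌋)) ^ (-(1/2:ℝ))

/-- The CLUSTER SET `𝒞` of the route: the `S` with `S = 0` off `NonCoincident` and
`F_{u k}(n,·) → S n` locally uniformly on `NonCoincident 3 n` for all `n`, along some sequence
`u k → 0⁺` in `(0,1]` (verbatim the crux's set-builder, with `ρ★` named). -/
def clusterSet : Set (CorrFamily 3) :=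
  {S | (∀ n x, x ∉ NonCoincident 3 n → S n x = 0) ∧ ∃ u : ℕ → ℝ, (∀ k, u k ∈ Set.Ioc (0:ℝ) 1) ∧
    Filter.Tendsto u Filter.atTop (nhds 0) ∧ ∀ n, TendstoLocallyUniformlyOn
      (fun k => rescaledCorrelator (criticalCorr 3) rhoStar n (u k)) (S n) Filter.atTop (NonCoincident 3 n)}

/-- The crux, read through the vocabulary: `ClusterSetTotallyDisconnected ↔ IsTotallyDisconnected 𝒞`
(definitional). -/
theorem clusterSetTotallyDisconnected_iff :
    Summit.CriticalPhenomena.Ising3DConformalLimit.Theses.ClusterRigidity.ClusterSetTotallyDisconnected ↔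
      IsTotallyDisconnected clusterSet :=
  Iff.rfl

/-- Stub 1, read through the vocabulary (definitional). -/
theorem stub_twoPointImageTD_iff :
    Registered.stub_twoPointImageTD ↔ IsTotallyDisconnected ((fun S : CorrFamily 3 => S 2) '' clusterSet) :=
  Iff.rfl

/-- Stub 2, read through the vocabulary (definitional). -/
theorem stub_fibrewiseTD_iff :
    Registered.stub_fibrewiseTD ↔ ∀ G : (Fin 2 → EuclideanSpace ℝ (Fin 3)) → ℝ,
      IsTotallyDisconnected {S : CorrFamily 3 | S ∈ clusterSet ∧ (fun S : CorrFamily 3 => S 2) S = G} :=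
  Iff.rfl

/-- The two-point projection `S ↦ S 2` is continuous for the pointwise (product) topology of
`CorrFamily 3` — it is a coordinate projection. [folklore] -/
theorem continuous_twoPoint : Continuous (fun S : CorrFamily 3 => S 2) :=
  continuous_apply 2

/-- NATURAL DISCHARGER OF STUB 1 (the route's lattice partial engine): if all cluster points share ONE
two-point function — what `DimensionPinned` + scale covariance of cluster points + the pinned frame
`S 2 (0,e₁) = 1` deliver — then the two-point image of `𝒞` is a subsingleton, hence totally
disconnected. [folklore] -/
theorem twoPointImageTD_of_pinned
    (h : ∃ G : (Fin 2 → EuclideanSpace ℝ (Fin 3)) → ℝ, ∀ S ∈ clusterSet, S 2 = G) :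
    Registered.stub_twoPointImageTD := by
  obtain ⟨G, hG⟩ := h
  rw [stub_twoPointImageTD_iff]
  refine isTotallyDisconnected_of_subsingleton ?_
  rintro _ ⟨S, hS, rfl⟩ _ ⟨T, hT, rfl⟩
  simp only [hG S hS, hG T hT]

/-- NATURAL DISCHARGER OF STUB 2 (strongest form of fibrewise isolation): if the two-point function
DETERMINES the cluster point (`S ↦ S 2` injective on `𝒞`), every two-point fibre of `𝒞` is a
subsingleton, hence totally disconnected. [folklore] -/
theorem fibrewiseTD_of_injOn (h : Set.InjOn (fun S : CorrFamily 3 => S 2) clusterSet) :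
    Registered.stub_fibrewiseTD := by
  rw [stub_fibrewiseTD_iff]
  intro G
  refine isTotallyDisconnected_of_subsingleton ?_
  rintro S ⟨hS, hSG⟩ T ⟨hT, hTG⟩
  exact h hS hT (hSG.trans hTG.symm)

end Glue

/-- ASSEMBLY (kernel-checked, no sorry): the two stubs imply the crux, literally the route decl
`Summit.CriticalPhenomena.Ising3DConformalLimit.Theses.ClusterRigidity.ClusterSetTotallyDisconnected`.
The glue lemma `isTotallyDisconnected_of_fibres` is applied to the continuous two-point projection
`S ↦ S 2` on the cluster set: stub 1 is its totally-disconnected-image hypothesis, stub 2 its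
totally-disconnected-fibres hypothesis (both read through the definitional vocabulary). -/
theorem ClusterSetTotallyDisconnected_of (h1 : Registered.stub_twoPointImageTD)
    (h2 : Registered.stub_fibrewiseTD) :
    Summit.CriticalPhenomena.Ising3DConformalLimit.Theses.ClusterRigidity.ClusterSetTotallyDisconnected := by
  rw [clusterSetTotallyDisconnected_iff]
  rw [stub_twoPointImageTD_iff] at h1
  rw [stub_fibrewiseTD_iff] at h2
  exact isTotallyDisconnected_of_fibres (fun S : Literature.Probability.LatticeModels.CorrFamily 3 => S 2)
    continuous_twoPoint.continuousOn h1 h2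

/-- The same assembly with the registered stubs plugged in (consistency check of the aliases;
sorries only inside `stub_*`). -/
theorem ClusterSetTotallyDisconnected_of_stubs :
    Summit.CriticalPhenomena.Ising3DConformalLimit.Theses.ClusterRigidity.ClusterSetTotallyDisconnected :=
  ClusterSetTotallyDisconnected_of stub_twoPointImageTD stub_fibrewiseTD

end Summit.CriticalPhenomena.Ising3DConformalLimit.Cruxes.ClusterSetTotallyDisconnected.Birth
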